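import Summits.ResolutionOfSingularities.ResolutionOfSingularities.Theorems.FrobeniusLadderFInjectiveMacaulayficationX2Cubic4VertexFull
import HarnessLib

/-!
# T-side CLASS (L): the point floor of a double point `x² + F₃` is F-PURE (FULL clause) at EVERY closed point of each singular chart `X₄² + X_a·W` as soon as `V(W)` is SMOOTH —
# a POINTWISE, characteristic-free Fedder argument (no global certificate)
# (crux `FInjectiveMacaulayfication` stmt-ResolutionOfSingularities-15315, chain w45a; res-L1-w45a-plan-1 ANSWER 00:15Z «(H) with a target: discharge the class row's FLOOR-FULLness
# premise p-uniformly … at P ∈ Σ the chart equation is a² + b·c»; generalises res-L1-w45a-lead-1 g11's ✓p677212 `X2Cubic4FloorFullCert` (Fermat, global certificate) to every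
# smooth `W`; seat res-L1-w45a-lead-1 g11)

[OURS · L1 W4.5a] Support file (`--supports stmt-ResolutionOfSingularities-15315 --as helper`); def-free; UNCONDITIONAL; no named fact; NOT a statement of any manuscript. AI-written
(AI review is weaker than expert review).

THE ARGUMENT (every prime `p`, every field of characteristic `p`). `g = X₄² + X_a·W` with `∂₄ W = ∂_a W = 0`; `𝔫 = (a₁,…,a_m)` a prime of `k[X]` containing `g`; `I = (a₁^p,…,a_m^p) ⊆ 𝔫` is
stable under EVERY derivation (`D(aᵖ·c) = aᵖ·Dc`). Suppose `g^{p−1} ∈ I`. LEADING-TERM LEMMA: for any derivation `D`, `D^{m}(h^m) = m!·(Dh)^m + h·R`.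
(A) `W ∉ 𝔫`: `D = ∂_a`, `Dg = W`: `(p−1)!·W^{p−1} ∈ I + (g) ⊆ 𝔫` ⇒ `W ∈ 𝔫`, contradiction. (B) `W ∈ 𝔫` (hence `X₄ ∈ 𝔫`), `X_a ∉ 𝔫`: smoothness gives `b` with `∂_b W ∉ 𝔫`; `D = ∂_b`,
`Dg = X_a·∂_bW ∉ 𝔫`; same contradiction. (C) `W, X_a ∈ 𝔫` (the SINGULAR points): `∂_a^{p−1}(g^{p−1}) = (p−1)!·W^{p−1}` EXACTLY (✓ `X2Cubic4FloorFullCert.iterate_pderiv_g_pow`), so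
`W^{p−1} ∈ I`; then `∂_b^{p−1}(W^{p−1}) = (p−1)!·(∂_bW)^{p−1} + W·R ∈ I ⊆ 𝔫` ⇒ `∂_b W ∈ 𝔫`, contradiction. Hence `g^{p−1} ∉ I`, which is exactly the input of
`FedderAtMaximalIdeal.stub_fedderAtMaximalIdeal` (Fedder 1983) ⇒ the FULL clause at every maximal ideal of `k[X]/(g)`.
* §1 `derivation_mem_span_pow` (Frobenius-power ideals are stable under every derivation), `iterate_derivation_mem_span_pow`, ★ `iterate_derivation_pow_leading`
  (the leading-term lemma), `apply_not_mem_of_pow_mem` (the one-line contradiction engine).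
* §2 ★★ `pow_not_mem_span_pow` (cases (A)(B)(C)), ★★ `clause_chart_smooth` — the FULL clause at EVERY closed point of `k[X]/(X₄² + X_a·W)` for EVERY prime `p`, from
  `∂₄W = ∂_aW = 0` and pointwise smoothness `∀` prime `𝔫 ∋ W` `∃ b, ∂_b W ∉ 𝔫` alone.
[cite: Fedder1983, Prop. 1.7, Thm. 1.12] [cite: StacksProject, Tag 07PF (context)] [folklore]
-/

-- single-problem summit: the doubled namespace component is forced
set_option linter.dupNamespace false

noncomputable section

open MvPolynomial

namespace Summit.ResolutionOfSingularities.ResolutionOfSingularities.Theorems.FInjectiveMacaulayfication.X2CubicFormFloorCert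

open Summit.ResolutionOfSingularities.ResolutionOfSingularities.Theorems.FInjectiveMacaulayfication

/-! ## §1 Derivations and Frobenius-power ideals -/

/-- **`(a₁^p, …, a_m^p)` is stable under every derivation** in characteristic `p` (`D(aᵖ·c) = aᵖ·Dc + c·p·aᵖ⁻¹·Da = aᵖ·Dc`). [elementary] -/
theorem derivation_mem_span_pow (p : ℕ) [Fact p.Prime] (k : Type) [Field k] [CharP k p] {n m : ℕ} (a : Fin m → MvPolynomial (Fin n) k)
    (D : Derivation k (MvPolynomial (Fin n) k) (MvPolynomial (Fin n) k)) {h : MvPolynomial (Fin n) k}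
    (hh : h ∈ Ideal.span (Set.range fun i : Fin m => a i ^ p)) : D h ∈ Ideal.span (Set.range fun i : Fin m => a i ^ p) := by
  induction hh using Submodule.span_induction with
  | mem x hx =>
      obtain ⟨i, rfl⟩ := hx
      have hp0 : (p : MvPolynomial (Fin n) k) = 0 := CharP.cast_eq_zero _ p
      rw [Derivation.leibniz_pow, smul_eq_mul, nsmul_eq_mul, hp0, zero_mul]
      exact Submodule.zero_mem _
  | zero => rw [map_zero]; exact Submodule.zero_mem _
  | add x y _ _ hx hy => rw [map_add]; exact Submodule.add_mem _ hx hy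
  | smul c x hx' hx =>
      rw [smul_eq_mul, Derivation.leibniz, smul_eq_mul, smul_eq_mul]
      exact Submodule.add_mem _ (Ideal.mul_mem_left _ _ hx) (Ideal.mul_mem_right _ _ hx')

/-- Iterates of a derivation keep `(a₁^p, …, a_m^p)` stable. [plumbing] -/
theorem iterate_derivation_mem_span_pow (p : ℕ) [Fact p.Prime] (k : Type) [Field k] [CharP k p] {n m : ℕ} (a : Fin m → MvPolynomial (Fin n) k)
    (D : Derivation k (MvPolynomial (Fin n) k) (MvPolynomial (Fin n) k)) :
    ∀ (j : ℕ) {h : MvPolynomial (Fin n) k}, h ∈ Ideal.span (Set.range fun i : Fin m => a i ^ p) →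
      (fun q => D q)^[j] h ∈ Ideal.span (Set.range fun i : Fin m => a i ^ p) := by
  intro j
  induction j with
  | zero => intro h hh; exact hh
  | succ j ih => intro h hh; rw [Function.iterate_succ_apply']; exact derivation_mem_span_pow p k a D (ih hh)

/-- ★ **THE LEADING-TERM LEMMA**: for a derivation `D` of a commutative ring and `j ≤ m`, `D^j(h^m) = m(m−1)⋯(m−j+1)·h^{m−j}·(Dh)^j + h^{m−j+1}·R` for some `R`; in particular
`D^m(h^m) = m!·(Dh)^m + h·R`. [folklore] -/
theorem iterate_derivation_pow_leading {A : Type} [CommRing A] {S₀ : Type} [CommRing S₀] [Algebra S₀ A] (D : Derivation S₀ A A) (h : A) (m : ℕ) :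
    ∀ j : ℕ, j ≤ m → ∃ R : A, (fun q => D q)^[j] (h ^ m) = (m.descFactorial j : A) * h ^ (m - j) * D h ^ j + h ^ (m - j + 1) * R := by
  intro j
  induction j with
  | zero => intro _; exact ⟨0, by simp⟩
  | succ j ih =>
      intro hj
      obtain ⟨R, hR⟩ := ih (Nat.le_of_succ_le hj)
      refine ⟨(m.descFactorial j : A) * (j : A) * D h ^ (j - 1) * D (D h) + ((m - j + 1 : ℕ) : A) * D h * R + h * D R, ?_⟩
      rw [Function.iterate_succ_apply', hR, map_add, Derivation.leibniz, Derivation.leibniz, Derivation.leibniz_pow, Derivation.leibniz_pow, Derivation.leibniz,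
        Derivation.leibniz_pow, Derivation.map_natCast, Nat.descFactorial_succ, show m - j - 1 = m - (j + 1) from Nat.sub_sub m j 1]
      have hmj : m - j = m - (j + 1) + 1 := by omega
      simp only [smul_eq_mul, nsmul_eq_mul]
      rw [hmj]
      push_cast
      rcases Nat.eq_zero_or_pos j with rfl | hjpos
      · simp; ring
      · obtain ⟨j', rfl⟩ : ∃ j', j = j' + 1 := ⟨j - 1, by omega⟩
        simp only [Nat.add_sub_cancel]
        push_cast
        ring

/-- ★ **The contradiction engine**: if `h^m ∈ I` for an ideal `I ⊆ 𝔫` stable under the derivation `D`, `𝔫` prime, `h ∈ 𝔫`, and `m!` is a unit, then `D h ∈ 𝔫`. [OURS · elementary] -/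
theorem apply_mem_of_pow_mem {A : Type} [CommRing A] {S₀ : Type} [CommRing S₀] [Algebra S₀ A] (D : Derivation S₀ A A) (h : A) (m : ℕ)
    (hfac : IsUnit ((m.factorial : ℕ) : A)) (I 𝔫 : Ideal A) [𝔫.IsPrime] (hI : I ≤ 𝔫) (hID : ∀ x ∈ I, D x ∈ I) (hh𝔫 : h ∈ 𝔫) (hhI : h ^ m ∈ I) : D h ∈ 𝔫 := by
  obtain ⟨R, hR⟩ := iterate_derivation_pow_leading D h m m le_rfl
  rw [Nat.descFactorial_self, Nat.sub_self, pow_zero, mul_one, zero_add, pow_one] at hR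
  have hiter : ∀ (j : ℕ) {x : A}, x ∈ I → (fun q => D q)^[j] x ∈ I := by
    intro j
    induction j with
    | zero => intro x hx; exact hx
    | succ j ih => intro x hx; rw [Function.iterate_succ_apply']; exact hID _ (ih hx)
  have hmem : (m.factorial : A) * D h ^ m ∈ 𝔫 := by
    have h1 : (fun q => D q)^[m] (h ^ m) ∈ 𝔫 := hI (hiter m hhI)
    rw [hR] at h1
    have h2 : h * R ∈ 𝔫 := 𝔫.mul_mem_right _ hh𝔫
    have := 𝔫.sub_mem h1 h2
    rwa [add_sub_cancel_right] at this
  obtain ⟨u, hu⟩ := hfac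
  have hpow : D h ^ m ∈ 𝔫 := by
    have := 𝔫.mul_mem_left (↑u⁻¹ : A) hmem
    rwa [← mul_assoc, ← hu, Units.inv_mul, one_mul] at this
  exact Ideal.IsPrime.mem_of_pow_mem inferInstance m hpow

/-! ## §2 The chart `g = X₄² + X_a·W` with `V(W)` smooth: `g^{p−1} ∉ (a₁^p, …, a_m^p)` at every prime `(a) ∋ g`, and the FULL clause -/

/-- ★★ **`g^{p−1} ∉ (a₁^p, …, a_m^p)`** for `g = X₄² + X_a·W` (`a ≠ 4`, `∂₄W = ∂_aW = 0`), every prime `𝔫 = (a₁,…,a_m) ∋ g` of `k[X₀..X₄]`, provided `V(W)` is SMOOTH in the pointwise sense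
(`∀` prime `𝔮 ∋ W` `∃ b, ∂_b W ∉ 𝔮`). Cases (A) `W ∉ 𝔫`, (B) `W ∈ 𝔫 ∌ X_a`, (C) `W, X_a ∈ 𝔫` as in the file header. Every prime `p`, every field. [OURS; cite: Fedder1983, Thm. 1.12 (context)] -/
theorem pow_not_mem_span_pow (p : ℕ) [Fact p.Prime] (k : Type) [Field k] [CharP k p] (a : Fin 5) (ha4 : a ≠ 4) (W g : MvPolynomial (Fin 5) k)
    (hg : g = X 4 ^ 2 + X a * W) (hWa : pderiv a W = 0) (hW4 : pderiv 4 W = 0)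
    (hWs : ∀ 𝔮 : Ideal (MvPolynomial (Fin 5) k), 𝔮.IsPrime → W ∈ 𝔮 → ∃ b : Fin 5, pderiv b W ∉ 𝔮)
    {m : ℕ} (gen : Fin m → MvPolynomial (Fin 5) k) (h𝔫 : (Ideal.span (Set.range gen)).IsPrime) (hg𝔫 : g ∈ Ideal.span (Set.range gen)) :
    g ^ (p - 1) ∉ Ideal.span (Set.range fun i : Fin m => gen i ^ p) := by
  intro hgI
  have hp : p.Prime := Fact.out
  haveI := h𝔫
  set 𝔫 := Ideal.span (Set.range gen) with h𝔫def
  set I := Ideal.span (Set.range fun i : Fin m => gen i ^ p) with hIdef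
  have hI : I ≤ 𝔫 := by
    rw [hIdef, Ideal.span_le]
    rintro _ ⟨i, rfl⟩
    exact 𝔫.pow_mem_of_mem (Ideal.subset_span ⟨i, rfl⟩) _ hp.pos
  have hID : ∀ (D : Derivation k (MvPolynomial (Fin 5) k) (MvPolynomial (Fin 5) k)), ∀ x ∈ I, D x ∈ I := fun D x hx => derivation_mem_span_pow p k gen D hx
  have hfac : IsUnit ((((p - 1).factorial : ℕ)) : MvPolynomial (Fin 5) k) := by
    rw [← map_natCast (C : k →+* MvPolynomial (Fin 5) k)]
    exact (Ne.isUnit (X2Cubic4VertexFull.factorial_cast_ne_zero k p _ (Nat.sub_lt hp.pos Nat.one_pos))).map C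
  have hdag : (pderiv a : Derivation k (MvPolynomial (Fin 5) k) (MvPolynomial (Fin 5) k)) g = W := by
    rw [hg, map_add, Derivation.leibniz_pow, pderiv_X_of_ne (Ne.symm ha4), smul_zero, smul_zero, zero_add, Derivation.leibniz, hWa, pderiv_X_self, smul_zero,
      zero_add, smul_eq_mul, mul_one]
  by_cases hW : W ∈ 𝔫
  · by_cases hXa : (X a : MvPolynomial (Fin 5) k) ∈ 𝔫
    · -- (C) the singular points: `∂_a^{p−1}(g^{p−1}) = (p−1)!·W^{p−1}` exactly, then `∂_b^{p−1}`
      obtain ⟨b, hb⟩ := hWs 𝔫 h𝔫 hW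
      have hWpow : W ^ (p - 1) ∈ I := by
        have h1 := iterate_derivation_mem_span_pow p k gen (pderiv a : Derivation k (MvPolynomial (Fin 5) k) (MvPolynomial (Fin 5) k)) (p - 1) hgI
        have h2 : (fun q => (pderiv a : Derivation k (MvPolynomial (Fin 5) k) (MvPolynomial (Fin 5) k)) q)^[p - 1] (g ^ (p - 1)) =
            ((p - 1).factorial : MvPolynomial (Fin 5) k) * W ^ (p - 1) :=
          X2Cubic4FloorFullCert.iterate_pderiv_g_pow k p hp.pos a ha4 g W hg hWa
        rw [h2] at h1
        obtain ⟨u, hu⟩ := hfac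
        have := Ideal.mul_mem_left _ (↑u⁻¹ : MvPolynomial (Fin 5) k) h1
        rwa [← mul_assoc, ← hu, Units.inv_mul, one_mul] at this
      exact hb (apply_mem_of_pow_mem (pderiv b : Derivation k (MvPolynomial (Fin 5) k) (MvPolynomial (Fin 5) k)) W (p - 1) hfac I 𝔫 hI (hID _) hW hWpow)
    · -- (B) `W ∈ 𝔫 ∌ X_a`: `D = ∂_b` with `∂_b W ∉ 𝔫`; `b ∉ {a, 4}` and `Dg = X_a·∂_b W ∉ 𝔫`
      obtain ⟨b, hb⟩ := hWs 𝔫 h𝔫 hW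
      have hba : b ≠ a := fun hba => hb (by rw [hba, hWa]; exact 𝔫.zero_mem)
      have hb4 : b ≠ 4 := fun hb4 => hb (by rw [hb4, hW4]; exact 𝔫.zero_mem)
      have hDg : (pderiv b : Derivation k (MvPolynomial (Fin 5) k) (MvPolynomial (Fin 5) k)) g = X a * pderiv b W := by
        rw [hg, map_add, Derivation.leibniz_pow, pderiv_X_of_ne (Ne.symm hb4), smul_zero, smul_zero, zero_add, Derivation.leibniz, pderiv_X_of_ne (Ne.symm hba),
          smul_zero, add_zero, smul_eq_mul]
      have hmem := apply_mem_of_pow_mem (pderiv b : Derivation k (MvPolynomial (Fin 5) k) (MvPolynomial (Fin 5) k)) g (p - 1) hfac I 𝔫 hI (hID _) hg𝔫 hgI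
      rw [hDg] at hmem
      rcases h𝔫.mem_or_mem hmem with h1 | h2
      · exact hXa h1
      · exact hb h2
  · -- (A) `W ∉ 𝔫`: `D = ∂_a`, `Dg = W`
    have hmem := apply_mem_of_pow_mem (pderiv a : Derivation k (MvPolynomial (Fin 5) k) (MvPolynomial (Fin 5) k)) g (p - 1) hfac I 𝔫 hI (hID _) hg𝔫 hgI
    rw [hdag] at hmem
    exact hW hmem

/-- ★★ **THE FULL CLAUSE AT EVERY CLOSED POINT OF A SINGULAR CHART, CLASS LEVEL**: for `g = X₄² + X_a·W` (`a ≠ 4`, `∂_aW = ∂₄W = 0`, `g ≠ 0`) with `V(W)` SMOOTH in the pointwise sense,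
every prime `p` and every field of characteristic `p`: at every maximal ideal `Q` of `k[X]/(g)` every parameter ideal is generated by a regular sequence and is Frobenius closed
(`FedderAtMaximalIdeal.stub_fedderAtMaximalIdeal` on `pow_not_mem_span_pow`). This is the `hpts` input of `GermOfGlobalBlowup.hypersurfacePointBlowup_fullCl` for the class row.
[OURS · assembly; cite: Fedder1983, Prop. 1.7, Thm. 1.12] -/
theorem clause_chart_smooth (p : ℕ) [Fact p.Prime] (k : Type) [Field k] [CharP k p] (a : Fin 5) (ha4 : a ≠ 4) (W g : MvPolynomial (Fin 5) k)
    (hg : g = X 4 ^ 2 + X a * W) (hWa : pderiv a W = 0) (hW4 : pderiv 4 W = 0) (hg0 : g ≠ 0)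
    (hWs : ∀ 𝔮 : Ideal (MvPolynomial (Fin 5) k), 𝔮.IsPrime → W ∈ 𝔮 → ∃ b : Fin 5, pderiv b W ∉ 𝔮)
    (Q : Ideal (MvPolynomial (Fin 5) k ⧸ Ideal.span {g})) [Q.IsMaximal] :
    ∀ d : ℕ, ringKrullDim (Localization.AtPrime Q) = d → ∀ s : Fin d → Localization.AtPrime Q,
      (Ideal.span (Set.range s)).radical.IsMaximal →
        RingTheory.Sequence.IsWeaklyRegular (Localization.AtPrime Q) (List.ofFn s) ∧
        ∀ y : Localization.AtPrime Q, (∃ e : ℕ, y ^ p ^ e ∈ Ideal.span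
          ((fun z : Localization.AtPrime Q => z ^ p ^ e) ''
            (Ideal.span (Set.range s) : Set (Localization.AtPrime Q)))) → y ∈ Ideal.span (Set.range s) := by
  obtain ⟨m, gen, hgen⟩ := Submodule.fg_iff_exists_fin_generating_family.mp (IsNoetherian.noetherian (Q.comap (Ideal.Quotient.mk (Ideal.span {g}))))
  have hP : Q.comap (Ideal.Quotient.mk (Ideal.span {g})) = Ideal.span (Set.range gen) := hgen.symm
  have hprime : (Ideal.span (Set.range gen)).IsPrime := by rw [← hP]; exact Ideal.comap_isPrime _ Q
  have hgm : g ∈ Ideal.span (Set.range gen) := by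
    rw [← hP, Ideal.mem_comap, Ideal.Quotient.eq_zero_iff_mem.mpr (Ideal.mem_span_singleton_self g)]
    exact Q.zero_mem
  exact FedderAtMaximalIdeal.stub_fedderAtMaximalIdeal p k 5 m gen g Q hP hg0 (pow_not_mem_span_pow p k a ha4 W g hg hWa hW4 hWs gen hprime hgm)

end Summit.ResolutionOfSingularities.ResolutionOfSingularities.Theorems.FInjectiveMacaulayfication.X2CubicFormFloorCert

end
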